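import Mathlib
import HarnessLib

/-!
# LINE (A) `product_plus_one` (crux `MatrixDescartes`, stmt-ValiantsHypothesis-18050, V1) — THE PHASE LENS: the two WRONSKIAN bookkeeping lemmas of
# THEOREM W (p3 g20 NOTE rev 5/6 §3.4; crit-6 g8 #71 (W0)/(W3); pen val-idea-25 g7 price P-W3, 2026-08-29 13:53:54Z)

Def-free companion of ✓ `…ProductPlusOneLensAlgebra` (p721591).  With `θ := X·d/dX` (so that `θ = d/du` after `X = e^u`, §1) and, for a real
polynomial `P`, the Theorem-W object `W := P·θ²P − (θP)²`:

* §1 `lensW_hasDerivAt_eval_exp` : `d/du [p(e^u)] = (θp)(e^u)` — the `θ = d/du` dictionary.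
* §2 **(W0)** `lensW_eq_X_mul_wronskian` : `W = X·wronskian P (θP)` (Mathlib's `Polynomial.wronskian a b = a·b′ − a′·b`);
  `lensW_eval_eq_sq_mul_theta_logDeriv` : off the roots `W(x) = P(x)²·(x·(θP/P)′(x))`, i.e. `W = P²·θ(θP/P) = P²·H′`, `H := θP/P`;
  `lensW_deriv_logDeriv_exp` : the same in `u`-currency, `d/du H(e^u) = W(e^u)/P(e^u)²`;
  `lensW_eval_root` : at a root `W(x₀) = −(x₀·P′(x₀))²`; ★ `lensW_eval_root_eq_zero_iff` : for `P ≠ 0`, `x₀ ≠ 0`, `P(x₀) = 0`: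
  `W(x₀) = 0 ↔ 1 < rootMultiplicity x₀ P` (simple roots give `W(x₀) < 0`, `lensW_eval_simple_root_neg`) — the `⌊M/2⌋` term of Theorem W.
* §3 **(W3)** `lensW_theta_quotient_numerator` : `θA·D − A·θD = X·wronskian D A`; `lensW_theta_quotient_eval` : off the poles
  `x·(A/D)′(x) = X·wronskian D A / D²`; `lensW_natDegree_wronskian_le` : `deg A ≤ m + 1`, `deg D ≤ m + 2` ⇒ `deg wronskian D A ≤ 2m + 2`, and its
  terminal instance ★ `lensW_terminal_derivative_numerator_natDegree` : `deg N ≤ 4n − 2`, `deg D ≤ 4n` ⇒ `deg wronskian D (X·N) ≤ 8n − 2`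
  (the numerator of `F₂′` for `F₂ = X·N(X)/D(X)`, ✓ `lens_terminal_numerator_degree`); ★ `lensW_wronskian_ne_zero_of_isRoot_zero` : `A ≠ 0`,
  `A(0) = 0`, `D(0) ≠ 0` ⇒ `wronskian D A ≠ 0` (so `F₂′ ≢ 0` unless `N = 0`, `lensW_terminal_derivative_numerator_ne_zero`); and the count
  ★ `lensW_terminal_derivative_zeros_le` : the zeros of `(X·N/D)′` off `X = 0` and off the poles number at most `8n − 2`.

HONEST FRAMING: polynomial bookkeeping (helper) for a PAPER theorem (Theorem W is paper-proved on the binomial sub-class, pen 13:53:54Z); nothing here is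
about `WronskianBudgetK3` / `OneChangeFloorK3` / 18050 / `MatrixDescartes` (clouds are inside every stub's quantifier); `VP ≠ VNP` is NOT proved.
No definitions, no named facts, no sorry.
-/

set_option linter.dupNamespace false

namespace Summit.ValiantsHypothesis.ValiantsHypothesis.Theorems.LacunarySymmetroidMatrixDescartes

namespace ProductPlusOne

open Polynomial

/-! ### §1 The dictionary `θ = X·d/dX = d/du` -/

/-- `d/du [p(e^u)] = (θp)(e^u)` with `θp := X·p′`. [this file's lemma] -/
theorem lensW_hasDerivAt_eval_exp (p : ℝ[X]) (u : ℝ) :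
    HasDerivAt (fun v => p.eval (Real.exp v)) ((X * derivative p).eval (Real.exp u)) u := by
  have h : HasDerivAt (fun v => p.eval (Real.exp v)) ((derivative p).eval (Real.exp u) * Real.exp u) u :=
    (p.hasDerivAt (Real.exp u)).comp u (Real.hasDerivAt_exp u)
  convert h using 1
  rw [eval_mul, eval_X, mul_comm]

/-! ### §2 (W0) `W := P·θ²P − (θP)²` is `P²·θ(θP/P)` off the roots, and `−(θP)²` at a root -/

/-- **(W0), polynomial form**: `P·θ(θP) − (θP)² = X·wronskian P (θP)`. [this file's lemma] -/
theorem lensW_eq_X_mul_wronskian (P : ℝ[X]) :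
    P * (X * derivative (X * derivative P)) - (X * derivative P) ^ 2 = X * wronskian P (X * derivative P) := by
  unfold wronskian
  ring

/-- **(W0), off the roots**: `W(x) = P(x)²·(x·(θP/P)′(x))`, i.e. `W = P²·θH` with `H := θP/P`. [this file's theorem] -/
theorem lensW_eval_eq_sq_mul_theta_logDeriv (P : ℝ[X]) {x : ℝ} (hx : P.eval x ≠ 0) :
    (P * (X * derivative (X * derivative P)) - (X * derivative P) ^ 2).eval x
      = (P.eval x) ^ 2 * (x * deriv (fun y => (X * derivative P).eval y / P.eval y) x) := by
  have hq : HasDerivAt (fun y => (X * derivative P).eval y / P.eval y)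
      (((derivative (X * derivative P)).eval x * P.eval x - (X * derivative P).eval x * (derivative P).eval x)
        / (P.eval x) ^ 2) x :=
    ((X * derivative P).hasDerivAt x).div (P.hasDerivAt x) hx
  rw [hq.deriv]
  simp only [eval_sub, eval_mul, eval_pow, eval_X]
  field_simp

/-- **(W0), `u`-currency**: with `X = e^u`, `d/du H(e^u) = W(e^u)/P(e^u)²` for `H = θP/P` off the roots. [this file's theorem] -/
theorem lensW_deriv_logDeriv_exp (P : ℝ[X]) {u : ℝ} (hu : P.eval (Real.exp u) ≠ 0) :
    deriv (fun v => (X * derivative P).eval (Real.exp v) / P.eval (Real.exp v)) u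
      = (P * (X * derivative (X * derivative P)) - (X * derivative P) ^ 2).eval (Real.exp u) / (P.eval (Real.exp u)) ^ 2 := by
  have hq : HasDerivAt (fun v => (X * derivative P).eval (Real.exp v) / P.eval (Real.exp v))
      (((X * derivative (X * derivative P)).eval (Real.exp u) * P.eval (Real.exp u)
          - (X * derivative P).eval (Real.exp u) * (X * derivative P).eval (Real.exp u)) / (P.eval (Real.exp u)) ^ 2) u :=
    (lensW_hasDerivAt_eval_exp (X * derivative P) u).div (lensW_hasDerivAt_eval_exp P u) hu
  rw [hq.deriv]
  simp only [eval_sub, eval_mul, eval_pow, eval_X]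
  ring

/-- **(W0), at a root**: `P(x₀) = 0 ⇒ W(x₀) = −(x₀·P′(x₀))²`. [this file's lemma] -/
theorem lensW_eval_root (P : ℝ[X]) {x₀ : ℝ} (h : P.IsRoot x₀) :
    (P * (X * derivative (X * derivative P)) - (X * derivative P) ^ 2).eval x₀ = -(x₀ * (derivative P).eval x₀) ^ 2 := by
  have h0 : P.eval x₀ = 0 := h
  simp only [eval_sub, eval_mul, eval_pow, eval_X, h0, zero_mul, zero_sub]

/-- ★ **(W0), the `⌊M/2⌋` term**: for `P ≠ 0` and a root `x₀ ≠ 0`, `W(x₀) = 0 ↔` the root is multiple (`1 < rootMultiplicity`). [this file's theorem] -/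
theorem lensW_eval_root_eq_zero_iff (P : ℝ[X]) (hP : P ≠ 0) {x₀ : ℝ} (hx : x₀ ≠ 0) (h : P.IsRoot x₀) :
    (P * (X * derivative (X * derivative P)) - (X * derivative P) ^ 2).eval x₀ = 0 ↔ 1 < P.rootMultiplicity x₀ := by
  rw [lensW_eval_root P h, one_lt_rootMultiplicity_iff_isRoot hP, neg_eq_zero, sq_eq_zero_iff, mul_eq_zero]
  constructor
  · rintro (h0 | h1)
    · exact (hx h0).elim
    · exact ⟨h, h1⟩
  · rintro ⟨-, h1⟩
    exact Or.inr h1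

/-- **(W0), simple roots**: at a simple root `x₀ ≠ 0`, `W(x₀) < 0`. [this file's lemma] -/
theorem lensW_eval_simple_root_neg (P : ℝ[X]) {x₀ : ℝ} (hx : x₀ ≠ 0) (h : P.IsRoot x₀) (h1 : ¬ (derivative P).IsRoot x₀) :
    (P * (X * derivative (X * derivative P)) - (X * derivative P) ^ 2).eval x₀ < 0 := by
  rw [lensW_eval_root P h, neg_lt_zero]
  have : x₀ * (derivative P).eval x₀ ≠ 0 := mul_ne_zero hx h1
  positivity

/-! ### §3 (W3) the numerator of `θ(A/D)`: `X·wronskian D A`, its degree, its non-vanishing, and the zero count -/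

/-- **(W3), polynomial form**: `θA·D − A·θD = X·wronskian D A` (`wronskian D A = D·A′ − D′·A`). [this file's lemma] -/
theorem lensW_theta_quotient_numerator (A D : ℝ[X]) :
    (X * derivative A) * D - A * (X * derivative D) = X * wronskian D A := by
  unfold wronskian
  ring

/-- **(W3), off the poles**: `x·(A/D)′(x) = x·(wronskian D A)(x)/D(x)²`, i.e. `θ(A/D) = X·wronskian D A/D²`. [this file's theorem] -/
theorem lensW_theta_quotient_eval (A D : ℝ[X]) {x : ℝ} (hx : D.eval x ≠ 0) :
    x * deriv (fun y => A.eval y / D.eval y) x = x * (wronskian D A).eval x / (D.eval x) ^ 2 := by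
  have hq : HasDerivAt (fun y => A.eval y / D.eval y)
      (((derivative A).eval x * D.eval x - A.eval x * (derivative D).eval x) / (D.eval x) ^ 2) x :=
    (A.hasDerivAt x).div (D.hasDerivAt x) hx
  rw [hq.deriv]
  unfold wronskian
  simp only [eval_sub, eval_mul]
  ring

/-- **(W3), degree**: `deg A ≤ m + 1`, `deg D ≤ m + 2` ⇒ `deg (wronskian D A) ≤ 2m + 2` (Mathlib's `natDegree_wronskian_lt_add`: the leading
terms of `D·A′` and `D′·A` combine to degree `< deg D + deg A`). [this file's lemma] -/
theorem lensW_natDegree_wronskian_le (A D : ℝ[X]) {m : ℕ} (hA : A.natDegree ≤ m + 1) (hD : D.natDegree ≤ m + 2) :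
    (wronskian D A).natDegree ≤ 2 * m + 2 := by
  by_cases hw : wronskian D A = 0
  · rw [hw, natDegree_zero]; exact Nat.zero_le _
  · have := natDegree_wronskian_lt_add hw
    omega

/-- ★ **(W3), the terminal instance**: for `F₂ = X·N(X)/D(X)` with `deg N ≤ 4n − 2` (✓ `lens_terminal_numerator_degree`) and `deg D ≤ 4n`
(`D = ∏_i Q₊(λ_iX)Q₋(λ_iX)`), the numerator `wronskian D (X·N)` of `θF₂ = F₂′(u)` has degree `≤ 8n − 2`. [this file's theorem] -/
theorem lensW_terminal_derivative_numerator_natDegree (N D : ℝ[X]) (n : ℕ) (hN : N.natDegree ≤ 4 * n - 2) (hD : D.natDegree ≤ 4 * n) :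
    (wronskian D (X * N)).natDegree ≤ 8 * n - 2 := by
  by_cases hw : wronskian D (X * N) = 0
  · rw [hw, natDegree_zero]; exact Nat.zero_le _
  · have h1 := natDegree_wronskian_lt_add hw
    have h2 : (X * N).natDegree ≤ 1 + N.natDegree := (natDegree_mul_le).trans (by rw [natDegree_X])
    omega

/-- ★ **(W3), non-vanishing**: if `A ≠ 0` vanishes at `0` and `D` does not, then `wronskian D A ≠ 0`.  (Write `A = X^m·A₀`, `m ≥ 1`, `A₀(0) ≠ 0`;
then `wronskian D A = X^{m−1}·(m·D·A₀ + X·wronskian D A₀)` and the bracket is `m·D(0)·A₀(0) ≠ 0` at `0`.) [this file's theorem] -/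
theorem lensW_wronskian_ne_zero_of_isRoot_zero (A D : ℝ[X]) (hA : A ≠ 0) (hA0 : A.IsRoot 0) (hD0 : ¬ D.IsRoot 0) :
    wronskian D A ≠ 0 := by
  obtain ⟨A₀, hAeq, hndvd⟩ := A.exists_eq_pow_rootMultiplicity_mul_and_not_dvd hA 0
  have hm : 0 < A.rootMultiplicity 0 := (rootMultiplicity_pos hA).2 hA0
  obtain ⟨k, hk⟩ : ∃ k, A.rootMultiplicity 0 = k + 1 := ⟨A.rootMultiplicity 0 - 1, by omega⟩
  rw [hk, map_zero, sub_zero] at hAeq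
  rw [map_zero, sub_zero, X_dvd_iff] at hndvd
  have hD0' : D.eval 0 ≠ 0 := hD0
  have hA00 : A₀.eval 0 ≠ 0 := by rwa [← coeff_zero_eq_eval_zero]
  -- the factorisation of the wronskian
  have hfac : wronskian D A = X ^ k * (C ((k : ℝ) + 1) * D * A₀ + X * wronskian D A₀) := by
    rw [hAeq]
    unfold wronskian
    rw [derivative_mul, derivative_X_pow]
    push_cast
    ring
  have hB : C ((k : ℝ) + 1) * D * A₀ + X * wronskian D A₀ ≠ 0 := by
    intro hB
    have := congrArg (fun p => p.eval 0) hB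
    simp only [eval_add, eval_mul, eval_C, eval_X, zero_mul, add_zero, eval_zero] at this
    have hk1 : ((k : ℝ) + 1) ≠ 0 := by positivity
    exact (mul_ne_zero (mul_ne_zero hk1 hD0') hA00) this
  rw [hfac]
  exact mul_ne_zero (pow_ne_zero _ X_ne_zero) hB

/-- **(W3), terminal non-vanishing**: `N ≠ 0`, `D(0) ≠ 0` ⇒ the numerator of `F₂′` is not the zero polynomial (`F₂′ ≢ 0` unless `F₂ ≡ 0`).
[this file's corollary] -/
theorem lensW_terminal_derivative_numerator_ne_zero (N D : ℝ[X]) (hN : N ≠ 0) (hD0 : D.eval 0 ≠ 0) :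
    wronskian D (X * N) ≠ 0 :=
  lensW_wronskian_ne_zero_of_isRoot_zero (X * N) D (mul_ne_zero X_ne_zero hN) (by simp [IsRoot]) hD0

/-- **(W3), zeros of `θ(A/D)` are roots of the wronskian**: off `x = 0` and off the poles, `(A/D)′(x) = 0 ↔ (wronskian D A)(x) = 0`.
[this file's lemma] -/
theorem lensW_deriv_quotient_eq_zero_iff (A D : ℝ[X]) {x : ℝ} (hx0 : x ≠ 0) (hx : D.eval x ≠ 0) :
    deriv (fun y => A.eval y / D.eval y) x = 0 ↔ (wronskian D A).eval x = 0 := by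
  have h := lensW_theta_quotient_eval A D hx
  have hD2 : (D.eval x) ^ 2 ≠ 0 := pow_ne_zero _ hx
  constructor
  · intro h0
    rw [h0, mul_zero] at h
    have := h.symm
    rw [div_eq_zero_iff] at this
    rcases this with h1 | h1
    · exact (mul_eq_zero.mp h1).resolve_left hx0
    · exact (hD2 h1).elim
  · intro h0
    rw [h0, mul_zero, zero_div, mul_eq_zero] at h
    exact h.resolve_left hx0

/-- ★ **(W3), the count**: for `F₂ = X·N/D` with `N ≠ 0`, `deg N ≤ 4n − 2`, `deg D ≤ 4n`, `D(0) ≠ 0`, the critical points of `F₂` off `x = 0` and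
off the poles are among the roots of a nonzero polynomial of degree `≤ 8n − 2`; in particular there are at most `8n − 2` of them.
[this file's theorem] -/
theorem lensW_terminal_derivative_zeros_le (N D : ℝ[X]) (n : ℕ) (hN : N ≠ 0) (hNd : N.natDegree ≤ 4 * n - 2)
    (hD : D.natDegree ≤ 4 * n) (hD0 : D.eval 0 ≠ 0) (S : Finset ℝ)
    (hS : ∀ x ∈ S, x ≠ 0 ∧ D.eval x ≠ 0 ∧ deriv (fun y => (X * N).eval y / D.eval y) x = 0) :
    S.card ≤ 8 * n - 2 := by
  classical
  have hw : wronskian D (X * N) ≠ 0 := lensW_terminal_derivative_numerator_ne_zero N D hN hD0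
  have hsub : S ⊆ (wronskian D (X * N)).roots.toFinset := by
    intro x hxS
    obtain ⟨hx0, hxD, hder⟩ := hS x hxS
    rw [Multiset.mem_toFinset, mem_roots hw, IsRoot.def]
    exact (lensW_deriv_quotient_eq_zero_iff (X * N) D hx0 hxD).mp hder
  calc S.card ≤ (wronskian D (X * N)).roots.toFinset.card := Finset.card_le_card hsub
    _ ≤ Multiset.card (wronskian D (X * N)).roots := Multiset.toFinset_card_le _
    _ ≤ (wronskian D (X * N)).natDegree := card_roots' _
    _ ≤ 8 * n - 2 := lensW_terminal_derivative_numerator_natDegree N D n hNd hD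

end ProductPlusOne

end Summit.ValiantsHypothesis.ValiantsHypothesis.Theorems.LacunarySymmetroidMatrixDescartes
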